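import Mathlib.RingTheory.Ideal.Maps
import Mathlib.RingTheory.Ideal.Quotient.Operations
import Mathlib.RingTheory.LocalRing.RingHom.Basic
import Mathlib.RingTheory.LocalRing.ResidueField.Basic
import Mathlib.RingTheory.Filtration
import Mathlib.RingTheory.Nakayama
import HarnessLib

/-!
# Formal immersions of local rings: the cotangent criterion and the rigidity of sections

Topic `Literature/RingTheory/CompleteLocalRings`. The commutative algebra behind the "key point"
of B. Mazur, *Rational isogenies of prime degree*, Invent. Math. 44 (1978), proof of Cor. 4.3
(p. 145), in the form in which it is used there and in every later descendant of the argument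
(Kamienny, Merel, Parent): a morphism `f : X → Y` of finite type between noetherian schemes is a
**formal immersion at a point `x`** when the induced map on completed local rings
`𝒪̂_{Y,f(x)} → 𝒪̂_{X,x}` is surjective (Mazur 1978, §3, p. 142, citing EGA IV 17.4.4), and then
*two sections of `X` over a local (or Dedekind) base which pass through `x` and have the same
image under `f` coincide* (p. 145: "Since this is a key point, we spell out the elementary proof
that the above diagram contradicts the fact that `f` is a formal immersion at `∞/k(𝔭)` …").

Everything is phrased for a ring homomorphism `φ : A →+* B` (think `φ = f^# : 𝒪_{Y,f(x)} → 𝒪_{X,x}`)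
and ideals `𝔪 ≤ A`, `𝔫 ≤ B` with `φ(𝔪) ⊆ 𝔫` (think: the maximal ideals), without completions:
for such data, surjectivity of `Â → B̂` is equivalent to the **level-wise surjectivity**
`A → B ⧸ 𝔫ᵏ` for every `k` (one direction because `B̂ → B/𝔫ᵏ` is onto and `Â → B/𝔫ᵏ` factors
through `A/𝔪ᵏ`, the other by successive approximation), and level-wise surjectivity is what the
rigidity argument consumes. Contents (all proved, no named facts):

* `exists_mem_sub_mem_sq_of_mem_map`, `exists_mem_pow_sub_mem_pow_succ` — the **cotangent
  criterion** in graded form: if `A → B/𝔫` is onto (equal residue fields) and `𝔫 ≤ φ(𝔪)B + 𝔫²`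
  (the cotangent map `𝔪 → 𝔫/𝔫²` is onto — the form in which Mazur's Prop. 3.1 establishes the
  formal immersion, via `Cot(A) → Cot(X₀(N)/k) ≅ k`, `ω ↦ a₁(ω)`), then every `y ∈ 𝔫ᵏ` is
  `φ(x) (mod 𝔫ᵏ⁺¹)` for some `x ∈ 𝔪ᵏ`;
* `exists_sub_mem_pow` / `surjective_mk_pow_comp` — hence `A → B/𝔫ᵏ` is onto for every `k`
  (formal immersion in Mazur's sense);
* `map_eq_of_le_sup_sq` — Nakayama form: for `𝔫` finitely generated inside the Jacobson radical,
  the cotangent condition forces `φ(𝔪)B = 𝔫`;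
* `ringHom_ext_of_forall_exists_sub_mem_pow` — **rigidity**: if `A → B/𝔫ᵏ` is onto for all `k`
  and `σ, τ : B →+* O` send `𝔫` into an ideal `𝔭` with `⋂ₖ 𝔭ᵏ = 0`, then `σ ∘ φ = τ ∘ φ` implies
  `σ = τ` (Mazur's two sections `x`, `∞` "crossing" at `𝔭`: `σ, τ` are the sections
  `𝒪_{X,∞̄} → 𝒪_𝔭`, `φ = f^#`, and `σ ∘ φ = τ ∘ φ` says `f(x) = f(∞)`);
* `ringHom_ext_of_isLocalHom`, `ringHom_ext_of_isLocalHom_of_isDomain` — the packaged statements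
  for local homomorphisms of local rings into a noetherian local ring, resp. into a noetherian
  domain (Krull's intersection theorem supplies `⋂ₖ 𝔭ᵏ = 0`).

Deliberately NOT here: the scheme-theoretic wrapper (sections `Spec O → X` through a point `x`
correspond to local homomorphisms `𝒪_{X,x} → O`, Mathlib `AlgebraicGeometry.SpecToEquivOfLocalRing`),
and the comparison with surjectivity of the map of adic completions; both are routine from the
statements below. This file is one formalizable step of the printed proof of Mazur 1978 Cor. 4.3 /
Cor. 4.4 (tree fact `Literature.NumberTheory.EllipticCurves.Mazur1978.cor44_valuation_j_le_one`);
the other inputs of that proof (`X₀(N)` over `ℤ`, the Eisenstein quotient and the finiteness of its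
Mordell–Weil group, Prop. 3.1) are not in the tree.

## References

* [Mazur1978] B. Mazur, *Rational isogenies of prime degree*, Invent. Math. 44 (1978) 129–162:
  §3 p. 142 (formal immersions), proof of Cor. 4.3, p. 145 (the rigidity argument).
* [Grothendieck1967] A. Grothendieck, J. Dieudonné, *EGA IV₄*, Publ. Math. IHÉS 32 (1967), 17.4.4.
* [Matsumura1987] H. Matsumura, *Commutative Ring Theory*, Thm. 8.4 (lifting surjectivity from the
  associated graded), Thm. 8.10 (Krull's intersection theorem).
-/

namespace Literature.RingTheory.CompleteLocalRings

open Ideal IsLocalRing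

variable {A B : Type*} [CommRing A] [CommRing B] (φ : A →+* B) {𝔪 : Ideal A} {𝔫 : Ideal B}

/-! ## The cotangent criterion, graded form -/

/-- **Cotangent criterion, degree one on `φ(𝔪)B`.** If `φ(𝔪) ⊆ 𝔫` and `A → B/𝔫` is onto, then
every element `w` of the extended ideal `φ(𝔪)B` is congruent modulo `𝔫²` to the image of an
element of `𝔪`: writing `w = Σ bᵢ φ(mᵢ)` and `bᵢ = φ(aᵢ) + sᵢ` with `sᵢ ∈ 𝔫` gives
`w ≡ φ(Σ aᵢ mᵢ) (mod 𝔫²)`. [folklore] (the first step of Matsumura 1987 Thm. 8.4 / EGA IV 17.4.4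
as used by Mazur 1978, §3 p. 142) -/
theorem exists_mem_sub_mem_sq_of_mem_map (hφ : 𝔪.map φ ≤ 𝔫)
    (hres : ∀ b : B, ∃ a : A, φ a - b ∈ 𝔫) {w : B} (hw : w ∈ 𝔪.map φ) :
    ∃ a ∈ 𝔪, φ a - w ∈ 𝔫 ^ 2 := by
  replace hw : w ∈ Submodule.span B (φ '' (𝔪 : Set A)) := hw
  induction hw using Submodule.span_induction with
  | mem x hx =>
    obtain ⟨m, hm, rfl⟩ := hx
    exact ⟨m, hm, by simp⟩
  | zero => exact ⟨0, 𝔪.zero_mem, by simp⟩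
  | add x y _ _ ihx ihy =>
    obtain ⟨a, ha, hax⟩ := ihx
    obtain ⟨b, hb, hby⟩ := ihy
    refine ⟨a + b, 𝔪.add_mem ha hb, ?_⟩
    have e : φ (a + b) - (x + y) = (φ a - x) + (φ b - y) := by rw [map_add]; ring
    rw [e]
    exact Ideal.add_mem _ hax hby
  | smul b x hx ihx =>
    obtain ⟨a, ha, hax⟩ := ihx
    obtain ⟨c, hc⟩ := hres b
    refine ⟨c * a, 𝔪.mul_mem_left c ha, ?_⟩
    have hxn : x ∈ 𝔫 := hφ hx
    have e : φ (c * a) - b • x = φ c * (φ a - x) + (φ c - b) * x := by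
      rw [map_mul, smul_eq_mul]; ring
    rw [e]
    refine Ideal.add_mem _ (Ideal.mul_mem_left _ _ hax) ?_
    rw [pow_two]
    exact Ideal.mul_mem_mul hc hxn

/-- **Cotangent criterion, graded form.** Let `φ : A →+* B`, `𝔪 ≤ A`, `𝔫 ≤ B` with `φ(𝔪) ⊆ 𝔫`,
`A → B/𝔫` onto, and suppose the cotangent map `𝔪 → 𝔫/𝔫²` is onto, in the elementwise form
"every `y ∈ 𝔫` is `φ(x) (mod 𝔫²)` for some `x ∈ 𝔪`" (see `exists_mem_sub_mem_sq_of_le_sup_sq` for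
the ideal-theoretic form `𝔫 ≤ φ(𝔪)B + 𝔫²`). Then for every `k`, every `y ∈ 𝔫ᵏ` is
`φ(x) (mod 𝔫ᵏ⁺¹)` for some `x ∈ 𝔪ᵏ`, i.e. `gr(φ) : gr_𝔪(A) → gr_𝔫(B)` is onto.
[folklore] (Matsumura 1987, Thm. 8.4; EGA IV 17.4.4) -/
theorem exists_mem_pow_sub_mem_pow_succ (hφ : 𝔪.map φ ≤ 𝔫)
    (hres : ∀ b : B, ∃ a : A, φ a - b ∈ 𝔫)
    (hcot : ∀ y ∈ 𝔫, ∃ x ∈ 𝔪, φ x - y ∈ 𝔫 ^ 2) (k : ℕ) :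
    ∀ y ∈ 𝔫 ^ k, ∃ x ∈ 𝔪 ^ k, φ x - y ∈ 𝔫 ^ (k + 1) := by
  induction k with
  | zero =>
    intro y _
    obtain ⟨a, ha⟩ := hres y
    exact ⟨a, by simp, by simpa using ha⟩
  | succ k ih =>
    intro y hy
    rw [pow_succ] at hy
    refine Submodule.mul_induction_on
      (C := fun y => ∃ x ∈ 𝔪 ^ (k + 1), φ x - y ∈ 𝔫 ^ (k + 1 + 1)) hy ?_ ?_
    · intro u hu v hv
      obtain ⟨x₁, hx₁, h₁⟩ := ih u hu
      obtain ⟨x₂, hx₂, h₂⟩ := hcot v hv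
      refine ⟨x₁ * x₂, ?_, ?_⟩
      · rw [pow_succ]
        exact Ideal.mul_mem_mul hx₁ hx₂
      · have e : φ (x₁ * x₂) - u * v = (φ x₁ - u) * φ x₂ + u * (φ x₂ - v) := by
          rw [map_mul]; ring
        rw [e]
        refine Ideal.add_mem _ ?_ ?_
        · rw [pow_succ]
          exact Ideal.mul_mem_mul h₁ (hφ (Ideal.mem_map_of_mem φ hx₂))
        · have h' : u * (φ x₂ - v) ∈ 𝔫 ^ (k + 2) := by
            rw [pow_add]
            exact Ideal.mul_mem_mul hu h₂
          exact h'
    · rintro x y ⟨a, ha, hax⟩ ⟨b, hb, hby⟩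
      refine ⟨a + b, Ideal.add_mem _ ha hb, ?_⟩
      have e : φ (a + b) - (x + y) = (φ a - x) + (φ b - y) := by rw [map_add]; ring
      rw [e]
      exact Ideal.add_mem _ hax hby

/-- The ideal-theoretic form of the cotangent hypothesis: if `φ(𝔪) ⊆ 𝔫`, `A → B/𝔫` is onto and
`𝔫 ≤ φ(𝔪)B + 𝔫²` (surjectivity of `𝔪 ⊗ k → 𝔫/𝔫²`), then every `y ∈ 𝔫` is `φ(x) (mod 𝔫²)`
for some `x ∈ 𝔪`. [folklore] -/
theorem exists_mem_sub_mem_sq_of_le_sup_sq (hφ : 𝔪.map φ ≤ 𝔫)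
    (hres : ∀ b : B, ∃ a : A, φ a - b ∈ 𝔫) (hcot : 𝔫 ≤ 𝔪.map φ ⊔ 𝔫 ^ 2) :
    ∀ y ∈ 𝔫, ∃ x ∈ 𝔪, φ x - y ∈ 𝔫 ^ 2 := by
  intro y hy
  obtain ⟨w, hw, r, hr, rfl⟩ := Submodule.mem_sup.mp (hcot hy)
  obtain ⟨a, ha, haw⟩ := exists_mem_sub_mem_sq_of_mem_map φ hφ hres hw
  refine ⟨a, ha, ?_⟩
  have e : φ a - (w + r) = (φ a - w) - r := by ring
  rw [e]
  exact Ideal.sub_mem _ haw hr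

/-! ## Level-wise surjectivity (formal immersion in Mazur's sense) -/

/-- **Formal immersion from the cotangent criterion.** Under the hypotheses of
`exists_mem_pow_sub_mem_pow_succ` (`φ(𝔪) ⊆ 𝔫`, `A → B/𝔫` onto, cotangent map onto), the map
`A → B/𝔫ᵏ` is onto for every `k`: every `b ∈ B` is `φ(a) (mod 𝔫ᵏ)` for some `a ∈ A`. For
`φ = f^# : 𝒪_{Y,f(x)} → 𝒪_{X,x}` and the maximal ideals this is the statement that `f` is a formal
immersion at `x` (Mazur 1978, §3, p. 142: "`𝒪̂_{Y,f(x)} → 𝒪̂_{X,x}` is surjective. This is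
equivalent to asking that the map induce an isomorphism between residue fields of `x` and `f(x)`,
and that `f` be formally unramified at `x` ([44] EGA IV 17.4.4)").
[folklore] (EGA IV 17.4.4; Matsumura 1987 Thm. 8.4) -/
theorem exists_sub_mem_pow (hφ : 𝔪.map φ ≤ 𝔫) (hres : ∀ b : B, ∃ a : A, φ a - b ∈ 𝔫)
    (hcot : ∀ y ∈ 𝔫, ∃ x ∈ 𝔪, φ x - y ∈ 𝔫 ^ 2) (k : ℕ) (b : B) :
    ∃ a : A, φ a - b ∈ 𝔫 ^ k := by
  induction k with
  | zero => exact ⟨0, by simp⟩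
  | succ k ih =>
    obtain ⟨a, ha⟩ := ih
    have hy : b - φ a ∈ 𝔫 ^ k := by simpa using (𝔫 ^ k).neg_mem ha
    obtain ⟨x, -, hx⟩ := exists_mem_pow_sub_mem_pow_succ φ hφ hres hcot k _ hy
    refine ⟨a + x, ?_⟩
    have e : φ (a + x) - b = φ x - (b - φ a) := by rw [map_add]; ring
    rw [e]
    exact hx

/-- Level-wise surjectivity as surjectivity of the ring homomorphisms `A → B ⧸ 𝔫ᵏ`.
[folklore] -/
theorem surjective_mk_pow_comp (hφ : 𝔪.map φ ≤ 𝔫) (hres : ∀ b : B, ∃ a : A, φ a - b ∈ 𝔫)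
    (hcot : ∀ y ∈ 𝔫, ∃ x ∈ 𝔪, φ x - y ∈ 𝔫 ^ 2) (k : ℕ) :
    Function.Surjective ((Ideal.Quotient.mk (𝔫 ^ k)).comp φ) := by
  intro q
  obtain ⟨b, rfl⟩ := Ideal.Quotient.mk_surjective q
  obtain ⟨a, ha⟩ := exists_sub_mem_pow φ hφ hres hcot k b
  exact ⟨a, by simpa [Ideal.Quotient.eq] using ha⟩

/-- **Nakayama form of the cotangent criterion.** If `φ(𝔪) ⊆ 𝔫`, `𝔫` is finitely generated and
contained in the Jacobson radical of `B` (e.g. `B` local noetherian and `𝔫` its maximal ideal),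
and `𝔫 ≤ φ(𝔪)B + 𝔫²`, then `φ(𝔪)B = 𝔫`: the closed fibre `B/φ(𝔪)B` is the residue ring `B/𝔫`
(so, with equal residue fields, `φ` is unramified at `𝔫` — the EGA IV 17.4.4 formulation).
[folklore] (Nakayama's lemma, Matsumura 1987 Thm. 2.2 / Cor.) -/
theorem map_eq_of_le_sup_sq (hφ : 𝔪.map φ ≤ 𝔫) (hfg : 𝔫.FG)
    (hjac : 𝔫 ≤ (⊥ : Ideal B).jacobson) (hcot : 𝔫 ≤ 𝔪.map φ ⊔ 𝔫 ^ 2) : 𝔪.map φ = 𝔫 := by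
  refine le_antisymm hφ ?_
  refine Submodule.le_of_le_smul_of_le_jacobson_bot hfg hjac ?_
  rwa [Ideal.smul_eq_mul, ← pow_two]

/-! ## Rigidity of sections -/

/-- **Rigidity of sections under a formal immersion** (Mazur 1978, proof of Cor. 4.3, p. 145, the
"key point" spelled out there: if `𝒪̂_{A,0} → 𝒪̂_{X,∞̄} = 𝒪_𝔭⟦q⟧` is surjective then the two
sections `q ↦ 0` (the cusp `∞`) and `q ↦ q₀` (the point `x`), which agree on `𝒪̂_{A,0}` because
`f(x) = f(∞) = 0`, must agree, contradicting `q₀ ≠ 0`). Abstract form: let `φ : A →+* B` be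
level-wise surjective for an ideal `𝔫 ≤ B` (every `b` is `φ(a) (mod 𝔫ᵏ)` for every `k`), and let
`σ, τ : B →+* O` be two ring homomorphisms mapping `𝔫` into an ideal `𝔭` of `O` which is
separated (`⋂ₖ 𝔭ᵏ = 0`). If `σ ∘ φ = τ ∘ φ` then `σ = τ`. Proof: `σ(b) - τ(b) =
τ(φ a - b) - σ(φ a - b) ∈ 𝔭ᵏ` for every `k`.
[cite: Mazur1978, proof of Cor. 4.3, p. 145] -/
theorem ringHom_ext_of_forall_exists_sub_mem_pow {O : Type*} [CommRing O]
    (hsurj : ∀ (k : ℕ) (b : B), ∃ a : A, φ a - b ∈ 𝔫 ^ k)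
    {𝔭 : Ideal O} (hsep : ⨅ k : ℕ, 𝔭 ^ k = ⊥)
    {σ τ : B →+* O} (hσ : 𝔫 ≤ 𝔭.comap σ) (hτ : 𝔫 ≤ 𝔭.comap τ)
    (h : σ.comp φ = τ.comp φ) : σ = τ := by
  refine RingHom.ext fun b => ?_
  rw [← sub_eq_zero, ← Ideal.mem_bot, ← hsep, Ideal.mem_iInf]
  intro k
  obtain ⟨a, ha⟩ := hsurj k b
  have hφa : σ (φ a) = τ (φ a) := RingHom.congr_fun h a
  have e : σ b - τ b = τ (φ a - b) - σ (φ a - b) := by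
    rw [map_sub, map_sub, hφa]; ring
  rw [e]
  refine Ideal.sub_mem _ ?_ ?_
  · exact Ideal.le_comap_pow τ k (Ideal.pow_right_mono hτ k ha)
  · exact Ideal.le_comap_pow σ k (Ideal.pow_right_mono hσ k ha)

/-- **Rigidity of sections, from the cotangent criterion.** If `φ(𝔪) ⊆ 𝔫`, `A → B/𝔫` is onto
and the cotangent map `𝔪 → 𝔫/𝔫²` is onto, then two ring homomorphisms `σ, τ : B →+* O` mapping
`𝔫` into a separated ideal `𝔭` (`⋂ₖ 𝔭ᵏ = 0`) and agreeing on `A` are equal.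
[cite: Mazur1978, proof of Cor. 4.3, p. 145 (with §3 p. 142, EGA IV 17.4.4)] -/
theorem ringHom_ext_of_cotangent {O : Type*} [CommRing O] (hφ : 𝔪.map φ ≤ 𝔫)
    (hres : ∀ b : B, ∃ a : A, φ a - b ∈ 𝔫) (hcot : ∀ y ∈ 𝔫, ∃ x ∈ 𝔪, φ x - y ∈ 𝔫 ^ 2)
    {𝔭 : Ideal O} (hsep : ⨅ k : ℕ, 𝔭 ^ k = ⊥)
    {σ τ : B →+* O} (hσ : 𝔫 ≤ 𝔭.comap σ) (hτ : 𝔫 ≤ 𝔭.comap τ)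
    (h : σ.comp φ = τ.comp φ) : σ = τ :=
  ringHom_ext_of_forall_exists_sub_mem_pow φ (exists_sub_mem_pow φ hφ hres hcot) hsep hσ hτ h

/-! ## Local homomorphisms of local rings -/

section LocalRing

variable [IsLocalRing A] [IsLocalRing B] [IsLocalHom φ]

/-- For a local homomorphism of local rings whose residue field map is onto, every `b ∈ B` is
`φ(a) (mod 𝔪_B)` for some `a ∈ A`. [folklore] -/
theorem exists_sub_mem_maximalIdeal_of_surjective_residueFieldMap
    (hres : Function.Surjective (ResidueField.map φ)) (b : B) :
    ∃ a : A, φ a - b ∈ maximalIdeal B := by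
  obtain ⟨ξ, hξ⟩ := hres (residue B b)
  obtain ⟨a, rfl⟩ := residue_surjective ξ
  rw [ResidueField.map_residue] at hξ
  exact ⟨a, (Ideal.Quotient.eq).mp hξ⟩

/-- **Rigidity of sections through a point at which a morphism is a formal immersion — local-ring
form** (Mazur 1978, proof of Cor. 4.3, p. 145). Let `φ : A →+* B` be a local homomorphism of local
rings which is onto on residue fields and onto on cotangent spaces
(`𝔪_B ≤ φ(𝔪_A)B + 𝔪_B²`) — i.e. `Spec φ` is a formal immersion at the closed point (EGA IV 17.4.4;
Mazur 1978 §3 p. 142). Then any two local homomorphisms `σ, τ : B →+* O` into a noetherian local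
ring `O` with `σ ∘ φ = τ ∘ φ` are equal. (In Mazur's application `A = 𝒪_{J̃,0}`, `B = 𝒪_{X₀(N),∞̄}`
at a prime `𝔭` of residue characteristic `p ≠ 2`, `O = 𝒪_𝔭`, and `σ, τ` are the sections `∞`
and `x`, which agree on `A` because `f(x) = 0 = f(∞)`.)
[cite: Mazur1978, proof of Cor. 4.3, p. 145] -/
theorem ringHom_ext_of_isLocalHom (hres : Function.Surjective (ResidueField.map φ))
    (hcot : maximalIdeal B ≤ (maximalIdeal A).map φ ⊔ maximalIdeal B ^ 2)
    {O : Type*} [CommRing O] [IsLocalRing O] [IsNoetherianRing O]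
    {σ τ : B →+* O} [IsLocalHom σ] [IsLocalHom τ] (h : σ.comp φ = τ.comp φ) : σ = τ := by
  have hφ : (maximalIdeal A).map φ ≤ maximalIdeal B := map_maximalIdeal_le φ
  have hres' := exists_sub_mem_maximalIdeal_of_surjective_residueFieldMap φ hres
  refine ringHom_ext_of_cotangent φ hφ hres' (exists_mem_sub_mem_sq_of_le_sup_sq φ hφ hres' hcot)
    (Ideal.iInf_pow_eq_bot_of_isLocalRing (maximalIdeal O) (maximalIdeal.isMaximal O).ne_top)
    (maximalIdeal_comap σ).ge (maximalIdeal_comap τ).ge h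

/-- **Rigidity of sections — sections with values in a noetherian domain** (e.g. `O` a Dedekind
domain or a discrete valuation ring and `𝔭` a maximal ideal: sections of `X → Spec O` meeting the
closed fibre over `𝔭` in the same point `x`, at which `f` is a formal immersion, and having the
same image under `f`, are equal; Mazur 1978, proof of Cor. 4.3, p. 145). Here `φ : A →+* B` is a
local homomorphism of local rings, onto on residue fields and on cotangent spaces, and
`σ, τ : B →+* O` map `𝔪_B` into a proper ideal `𝔭` of the noetherian domain `O`.
[cite: Mazur1978, proof of Cor. 4.3, p. 145] -/
theorem ringHom_ext_of_isLocalHom_of_isDomain (hres : Function.Surjective (ResidueField.map φ))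
    (hcot : maximalIdeal B ≤ (maximalIdeal A).map φ ⊔ maximalIdeal B ^ 2)
    {O : Type*} [CommRing O] [IsDomain O] [IsNoetherianRing O] {𝔭 : Ideal O} (h𝔭 : 𝔭 ≠ ⊤)
    {σ τ : B →+* O} (hσ : maximalIdeal B ≤ 𝔭.comap σ) (hτ : maximalIdeal B ≤ 𝔭.comap τ)
    (h : σ.comp φ = τ.comp φ) : σ = τ := by
  have hφ : (maximalIdeal A).map φ ≤ maximalIdeal B := map_maximalIdeal_le φ
  have hres' := exists_sub_mem_maximalIdeal_of_surjective_residueFieldMap φ hres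
  exact ringHom_ext_of_cotangent φ hφ hres' (exists_mem_sub_mem_sq_of_le_sup_sq φ hφ hres' hcot)
    (Ideal.iInf_pow_eq_bot_of_isDomain 𝔭 h𝔭) hσ hτ h

/-- Under the cotangent criterion for a local homomorphism of local rings with `B` noetherian,
the maximal ideal of `B` is generated by the image of the maximal ideal of `A`:
`φ(𝔪_A)B = 𝔪_B` (Nakayama). [folklore] -/
theorem map_maximalIdeal_eq_of_le_sup_sq [IsNoetherianRing B]
    (hcot : maximalIdeal B ≤ (maximalIdeal A).map φ ⊔ maximalIdeal B ^ 2) :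
    (maximalIdeal A).map φ = maximalIdeal B :=
  map_eq_of_le_sup_sq φ (map_maximalIdeal_le φ) (IsNoetherian.noetherian _)
    (maximalIdeal_le_jacobson _) hcot

end LocalRing

end Literature.RingTheory.CompleteLocalRings
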